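import Mathlib
import Summits.KontsevichZagierPeriods.KontsevichZagierPeriods.Theorems.InverseLandauTateFamilyKernelTameCertificate

/-!
# Crux `TateFamilyKernel` (stmt-KontsevichZagierPeriods-9130), line `Sketch` — stub `stub_assembly`

Certificate assembly for the induction on the dimension in the lead's skeleton of the crux
`Summit.KontsevichZagierPeriods.KontsevichZagierPeriods.Theses.InverseLandau.TateFamilyKernel`
(route `InverseLandau`), sequel of `InverseLandauTateFamilyKernelTameCertificate.lean`.

If a tame `f` on `[0,1]ⁿ`, read on `[0,1]^{n+m}` through the first `n` coordinates
(Kontsevich–Zagier, "introducing more variables"), equals there a finite sum of Ayoub elements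
`∂_{i_k} G_k − G_k|_{x_{i_k}=1} + G_k|_{x_{i_k}=0}` with tame data (Ayoub, EMS Newsl. 91 (2014),
Def. 10) PLUS finitely many tame terms `H_l`, each of whose tame cube representations is already
known to be a relation, then every tame representation of `f` is a relation:

* `tame_add_sum_mem_relations` — rule (1) (linearity, `KZ.mem_cubicalLinGens`) peels the terms
  `H_l` off a tame representation one at a time (induction on the finset);
* `stub_assembly` — the registered stub: `tame_liftN` (ignoring the last `m` coordinates is a
  relation) + `tame_sum_relA_mem_relations_dim` (the remaining sum of Ayoub elements) + the
  peeling lemma.  The case `t = ∅` is the landed `tame_certificate`.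

No named fact, no new definition.
-/

noncomputable section

open MeasureTheory Set MvPolynomial
open Literature.NumberTheory.Transcendental
open Literature.ModelTheory.ExponentialFields (IsSemialgebraic)

namespace Summit.KontsevichZagierPeriods.InverseLandau.TateFamilyKernel.Descent

/-- **Peeling tame relations off a tame representation** (rule (1), linearity, `|t|` times): if a
tame representation `S` of `[0,1]^D` has integrand `g + Σ_{l ∈ t} H_l` on the cube, where every
tame representation with integrand `g` on the cube is a relation and, for each `l ∈ t`, `H_l` is
tame and every tame representation with integrand `H_l` on the cube is a relation, then `S` is a
relation. [cite: KontsevichZagier2001, §1.2 rule (1)] -/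
theorem tame_add_sum_mem_relations {D : ℕ} {κ : Type*} (t : Finset κ) {g : (Fin D → ℝ) → ℝ}
    (hg : ∀ R : KZ.IntegralRep D, R.IsTameCube → (∀ w ∈ KZ.cube D, R.integrand w = g w) →
      KZ.of R ∈ KZ.relations)
    {H : κ → (Fin D → ℝ) → ℝ}
    (hHa : ∀ l ∈ t, AnalyticOnNhd ℝ (H l) (KZ.cube D))
    (hHs : ∀ l ∈ t, IsSemialgebraicFunOn ℚ (KZ.cube D) (H l))
    (hH : ∀ l ∈ t, ∀ R : KZ.IntegralRep D, R.IsTameCube →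
      (∀ w ∈ KZ.cube D, R.integrand w = H l w) → KZ.of R ∈ KZ.relations) :
    ∀ S : KZ.IntegralRep D, S.IsTameCube →
      (∀ w ∈ KZ.cube D, S.integrand w = g w + ∑ l ∈ t, H l w) → KZ.of S ∈ KZ.relations := by
  classical
  induction t using Finset.induction_on with
  | empty =>
    intro S hS hSi
    exact hg S hS fun w hw => by simpa using hSi w hw
  | insert a t ha ih =>
    intro S hS hSi
    have hat : a ∈ insert a t := Finset.mem_insert_self a t
    -- the tame representation `S'` of the remaining sum and the one `T` of `H a`
    have hS'a : AnalyticOnNhd ℝ (fun w => S.integrand w - H a w) (KZ.cube D) :=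
      hS.analyticOnNhd.sub (hHa a hat)
    have hS's : IsSemialgebraicFunOn ℚ (KZ.cube D) (fun w => S.integrand w - H a w) :=
      IsSemialgebraicFunOn.sub_holds hS.isSemialgebraicFunOn (hHs a hat)
    set S' : KZ.IntegralRep D := KZ.IntegralRep.tameCube _ hS'a hS's with hS'def
    set T : KZ.IntegralRep D := KZ.IntegralRep.tameCube _ (hHa a hat) (hHs a hat) with hTdef
    -- rule (1): `[S] − [S'] − [T]` is a linearity move
    have hlin : KZ.of S - KZ.of S' - KZ.of T ∈ KZ.relations :=
      KZ.cubicalLinGens_subset_relations (KZ.mem_cubicalLinGens hS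
        (KZ.IntegralRep.isTameCube_tameCube _ _ _) (KZ.IntegralRep.isTameCube_tameCube _ _ _)
        fun w _ => by simp [hS'def, hTdef])
    -- `[S']` is a relation by the induction hypothesis, `[T]` by assumption
    have hS' : KZ.of S' ∈ KZ.relations :=
      ih (fun l hl => hHa l (Finset.mem_insert_of_mem hl))
        (fun l hl => hHs l (Finset.mem_insert_of_mem hl))
        (fun l hl => hH l (Finset.mem_insert_of_mem hl)) S'
        (KZ.IntegralRep.isTameCube_tameCube _ _ _) fun w hw => by
          simp only [hS'def, KZ.IntegralRep.tameCube_integrand]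
          rw [hSi w hw, Finset.sum_insert ha]
          ring
    have hT : KZ.of T ∈ KZ.relations :=
      hH a hat T (KZ.IntegralRep.isTameCube_tameCube _ _ _) fun w _ => by simp [hTdef]
    have : KZ.of S = (KZ.of S - KZ.of S' - KZ.of T) + KZ.of S' + KZ.of T := by abel
    rw [this]
    exact KZ.relations.add_mem (KZ.relations.add_mem hlin hS') hT

/-- **Assembling a descent certificate** (tame certificates with extra relation terms): if a tame
`f` on `[0,1]ⁿ`, read on `[0,1]^{n+m}` through the first `n` coordinates, equals there a finite sum
of Ayoub elements `∂_{i_k} G_k − G_k|_{x_{i_k}=1} + G_k|_{x_{i_k}=0}` with tame data plus finitely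
many tame terms `H_l`, each of whose tame cube representations is a relation, then every tame
representation of `f` on `[0,1]ⁿ` is a relation (`tame_liftN` + `tame_sum_relA_mem_relations_dim`
+ linearity; the case `t = ∅` is `tame_certificate`).
[cite: Ayoub2014, Def. 10] [cite: KontsevichZagier2001, §1.1–1.2] -/
theorem stub_assembly {n m : ℕ} {ι κ : Type*} (s : Finset ι) (t : Finset κ) (i : ι → Fin (n + m))
    {f : (Fin n → ℝ) → ℝ} (hfa : AnalyticOnNhd ℝ f (KZ.cube n)) (hfs : IsSemialgebraicFunOn ℚ (KZ.cube n) f)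
    {G G' : ι → (Fin (n + m) → ℝ) → ℝ}
    (hGa : ∀ k ∈ s, AnalyticOnNhd ℝ (G k) (KZ.cube (n + m)))
    (hGs : ∀ k ∈ s, IsSemialgebraicFunOn ℚ (KZ.cube (n + m)) (G k))
    (hG'a : ∀ k ∈ s, AnalyticOnNhd ℝ (G' k) (KZ.cube (n + m)))
    (hG's : ∀ k ∈ s, IsSemialgebraicFunOn ℚ (KZ.cube (n + m)) (G' k))
    (hder : ∀ k ∈ s, ∀ w ∈ KZ.cube (n + m),
      HasDerivAt (fun t : ℝ => G k (Function.update w (i k) t)) (G' k w) (w (i k)))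
    {H : κ → (Fin (n + m) → ℝ) → ℝ}
    (hHa : ∀ l ∈ t, AnalyticOnNhd ℝ (H l) (KZ.cube (n + m)))
    (hHs : ∀ l ∈ t, IsSemialgebraicFunOn ℚ (KZ.cube (n + m)) (H l))
    (hH : ∀ l ∈ t, ∀ R : KZ.IntegralRep (n + m), R.IsTameCube →
      (∀ w ∈ KZ.cube (n + m), R.integrand w = H l w) → KZ.of R ∈ KZ.relations)
    (hcert : ∀ w ∈ KZ.cube (n + m),
      f (fun j => w (Fin.castAdd m j)) =
        (∑ k ∈ s, (G' k w - G k (Function.update w (i k) 1) + G k (Function.update w (i k) 0))) +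
          ∑ l ∈ t, H l w)
    (Φ : KZ.IntegralRep n) (hΦ : Φ.IsTameCube) (hΦi : ∀ z ∈ KZ.cube n, Φ.integrand z = f z) :
    KZ.of Φ ∈ KZ.relations := by
  -- `f` read in `n + m` variables, as a tame representation `A`
  have hva : AnalyticOnNhd ℝ (fun w : Fin (n + m) → ℝ => f (fun j => w (Fin.castAdd m j)))
      (KZ.cube (n + m)) := by
    obtain ⟨L, hL⟩ : ∃ L : (Fin (n + m) → ℝ) →L[ℝ] (Fin n → ℝ), ∀ v, L v = fun j => v (Fin.castAdd m j) :=
      ⟨ContinuousLinearMap.pi fun j => ContinuousLinearMap.proj (Fin.castAdd m j), fun v => by ext j; simp⟩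
    intro v hv
    have hvz : (fun j => v (Fin.castAdd m j)) ∈ KZ.cube n := fun j => KZ.mem_cube.1 hv _
    have hfL : AnalyticAt ℝ f (L v) := by rw [hL]; exact hfa _ hvz
    exact (hfL.comp (L.analyticAt v)).congr (Filter.Eventually.of_forall fun v' => by simp [hL])
  have hvs : IsSemialgebraicFunOn ℚ (KZ.cube (n + m))
      (fun w : Fin (n + m) → ℝ => f (fun j => w (Fin.castAdd m j))) :=
    IsSemialgebraicFunOn.comp_isSemialgebraicMapOn_holds hfs
      (IsSemialgebraicMapOn.of_forall KZ.isSemialgebraic_cube fun j =>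
        isSemialgebraicFunOn_apply KZ.isSemialgebraic_cube (Fin.castAdd m j))
      fun v hv j => KZ.mem_cube.1 hv _
  set A : KZ.IntegralRep (n + m) := KZ.IntegralRep.tameCube _ hva hvs with hAdef
  -- introducing more variables: `[A] − [Φ]` is a relation
  have hlift : KZ.of A - KZ.of Φ ∈ KZ.relations :=
    tame_liftN hfa hfs m A (KZ.IntegralRep.isTameCube_tameCube _ _ _) (fun w _ => by simp [hAdef])
      Φ hΦ hΦi
  -- `[A]` is a relation: peel off the `H l`, the rest is a sum of Ayoub elements
  have hA : KZ.of A ∈ KZ.relations :=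
    tame_add_sum_mem_relations t
      (g := fun w => ∑ k ∈ s, (G' k w - G k (Function.update w (i k) 1) + G k (Function.update w (i k) 0)))
      (fun R hR hRi => tame_sum_relA_mem_relations_dim s i hGa hGs hG'a hG's hder R hR hRi)
      hHa hHs hH A (KZ.IntegralRep.isTameCube_tameCube _ _ _) fun w hw => by
        simpa [hAdef] using hcert w hw
  have : KZ.of Φ = KZ.of A - (KZ.of A - KZ.of Φ) := by abel
  rw [this]
  exact KZ.relations.sub_mem hA hlift

end Summit.KontsevichZagierPeriods.InverseLandau.TateFamilyKernel.Descent

end
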